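import Summits.AtomisticToContinuum.BoseEinsteinCondensation.Theorems.BECCutLineWeakDisorderDefs
import Literature.Probability.Process.BrownianRunningSupFourthMoment
import HarnessLib

/-!
# Crux `TwoReplicaTransienceBound` (stmt-AtomisticToContinuum-9687): the cubic Wiener-sausage
# moment is finite, uniformly on bounded time windows

Support file (does not close the item) for the crux
`Summit.AtomisticToContinuum.BoseEinsteinCondensation.Theses.BECCutLineWeakDisorder.TwoReplicaTransienceBound`
(route `BECCutLineWeakDisorder`, line `SketchIdeator1`, skeleton v6, lead c3): the registered stub
`stub_sausageMoment` of the short-window insertion recursion.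

The error term of the insertion step is a Wiener-sausage volume: a bath Brownian line started at `y`
can meet the tagged line started at `x` within time `2T` only if `dist x y ≤ R + √2·(S(ω₀) + S(ω))`,
`S(ω) = Σ_{k<3} runSup h (ω k)`, `h = (2T)⁺`, where `runSup h η = sup_{s ≤ h} |b_s(η)|` is the running
supremum of one Brownian coordinate; the `y`-volume of that ball is at most `(2(R + √2(S + S')))³`.
Here we prove that the expectation of this cube over two independent lines (law `wienerLine`, three
independent pre-Wiener coordinates each) is bounded by an explicit finite constant `K(R, T₀)` for all
`T ≤ T₀`:

* `SausageMoment.sausage_cube_le` — the elementary bound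
  `(2(R + √2(a+b)))³ ≤ 1 + 128 R⁴ + 4096 (a⁴ + b⁴)` (all reals: `y³ ≤ 1 + y⁴`,
  `(u+v)⁴ ≤ 8(u⁴+v⁴)` twice);
* `SausageMoment.sum_runSup_pow_four_le` — `(Σ_{k<3} M_k)⁴ ≤ 27 Σ_k M_k⁴` (power mean);
* `SausageMoment.lintegral_runSup_apply_pow_four_le` — the one-coordinate marginal of `wienerLine`
  is the pre-Wiener measure (`MeasureTheory.measurePreserving_eval`), so
  `E[runSup h (ω k)⁴] ≤ 18 h²` (`Literature.Probability.Process.lintegral_runSup_pow_four_le`, Doob's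
  `L²` maximal inequality for `B² − t`);
* `SausageMoment.lintegral_sausage_cube_le` — the double integral at level `h` is at most
  `ofReal (1 + 128 R⁴) + 2 · 110592 · 3 · ofReal (18 h²)`;
* `TracerDecoupling.stub_sausageMoment` — the registered signature, with
  `K := ofReal (1 + 128 R⁴) + 2 · (110592 · (3 · ofReal (18 · ((2T₀)⁺)²)))` (monotonicity of
  `T ↦ (2T)⁺` only; no sharp constant is claimed).

## References

* D. Revuz, M. Yor, *Continuous Martingales and Brownian Motion* (1999), Ch. II Thm (1.7) (Doob's
  `Lᵖ` inequality, behind `lintegral_runSup_pow_four_le`). [RevuzYor1999]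
-/

noncomputable section

open MeasureTheory Set
open scoped ENNReal NNReal BigOperators

namespace Summit.AtomisticToContinuum.BoseEinsteinCondensation.Cruxes.TwoReplicaTransienceBound.TracerDecoupling.SausageMoment

open Literature.Probability.Process (runSup preWienerMeasure measurable_runSup runSup_nonneg
  lintegral_runSup_pow_four_le)

/-! ### Elementary real inequalities -/

/-- `y³ ≤ 1 + y⁴` for every real `y` (sum of squares:
`y⁴ − y³ + 1 = (y² − y/2 − 1/2)² + (3/4)(y − 1/3)² + 2/3`). -/
theorem pow_three_le_one_add_pow_four (y : ℝ) : y ^ 3 ≤ 1 + y ^ 4 := by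
  nlinarith [sq_nonneg (y ^ 2 - y / 2 - 1 / 2), sq_nonneg (y - 1 / 3)]

/-- **The elementary cube bound**: for all real `R, a, b` (used for `R, a, b ≥ 0`),
`(2(R + √2(a + b)))³ ≤ 1 + 128 R⁴ + 4096 (a⁴ + b⁴)`
(`y³ ≤ 1 + y⁴` with `y = 2R + 2√2(a+b)`, then `(u+v)⁴ ≤ 8(u⁴+v⁴)` twice and `(2√2)⁴ = 64`). -/
theorem sausage_cube_le (R a b : ℝ) :
    (2 * (R + Real.sqrt 2 * (a + b))) ^ 3 ≤ 1 + 128 * R ^ 4 + 4096 * (a ^ 4 + b ^ 4) := by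
  -- power mean `(u + v)⁴ ≤ 8 (u⁴ + v⁴)` for all reals
  -- (`8(u⁴+v⁴) − (u+v)⁴ = (u−v)² (5(u+v)² + 2u² + 2v²)`; the tree's
  -- `Literature.Geometry.MetricEmbeddings.add_pow_four_le`, inlined to keep the imports light)
  have hpm : ∀ u v : ℝ, (u + v) ^ 4 ≤ 8 * (u ^ 4 + v ^ 4) := fun u v => by
    nlinarith [mul_nonneg (sq_nonneg (u - v)) (sq_nonneg (u + v)),
      mul_nonneg (sq_nonneg (u - v)) (sq_nonneg u), mul_nonneg (sq_nonneg (u - v)) (sq_nonneg v)]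
  have hs2 : Real.sqrt 2 ^ 2 = 2 := Real.sq_sqrt zero_le_two
  have h1 := pow_three_le_one_add_pow_four (2 * (R + Real.sqrt 2 * (a + b)))
  have h2 : (2 * (R + Real.sqrt 2 * (a + b))) ^ 4 ≤ 128 * R ^ 4 + 512 * (a + b) ^ 4 := by
    have h := hpm (2 * R) (2 * Real.sqrt 2 * (a + b))
    have he : 2 * (R + Real.sqrt 2 * (a + b)) = 2 * R + 2 * Real.sqrt 2 * (a + b) := by ring
    have h4 : (2 * Real.sqrt 2 * (a + b)) ^ 4 = 64 * (a + b) ^ 4 := by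
      have : (2 * Real.sqrt 2 * (a + b)) ^ 4 = 16 * (Real.sqrt 2 ^ 2) ^ 2 * (a + b) ^ 4 := by ring
      rw [this, hs2]
      ring
    rw [he]
    calc (2 * R + 2 * Real.sqrt 2 * (a + b)) ^ 4
        ≤ 8 * ((2 * R) ^ 4 + (2 * Real.sqrt 2 * (a + b)) ^ 4) := h
      _ = 128 * R ^ 4 + 512 * (a + b) ^ 4 := by
          rw [h4]
          ring
  have h3 := hpm a b
  linarith

/-- **Power mean over the three coordinates**: `(Σ_{k<3} runSup h (ω k))⁴ ≤ 27 Σ_k runSup h (ω k)⁴`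
(`pow_sum_le_card_mul_sum_pow`, the summands being nonnegative). -/
theorem sum_runSup_pow_four_le (h : ℝ≥0) (ω : Fin 3 → (ℝ≥0 → ℝ)) :
    (∑ k, runSup h (ω k)) ^ 4 ≤ 27 * ∑ k, runSup h (ω k) ^ 4 := by
  calc (∑ k, runSup h (ω k)) ^ 4
      ≤ ((Finset.univ : Finset (Fin 3)).card : ℝ) ^ 3 * ∑ k, runSup h (ω k) ^ 4 :=
        pow_sum_le_card_mul_sum_pow (s := Finset.univ) (f := fun k : Fin 3 => runSup h (ω k))
          (fun k _ => runSup_nonneg h (ω k)) 3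
    _ = 27 * ∑ k, runSup h (ω k) ^ 4 := by norm_num [Finset.card_univ, Fintype.card_fin]

/-! ### The pointwise bound of the integrand -/

/-- **Pointwise bound of the sausage integrand** by a constant plus the fourth-moment functionals of
the two lines: `ofReal ((2(R + √2(S(ω₀) + S(ω))))³) ≤ ofReal (1 + 128R⁴) + 110592 Σ_k ofReal (M_k(ω₀)⁴)
+ 110592 Σ_k ofReal (M_k(ω)⁴)`, `M_k(ω) = runSup h (ω k)`, `S = Σ_k M_k` (`sausage_cube_le`,
`sum_runSup_pow_four_le`, `4096 · 27 = 110592`). -/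
theorem ofReal_sausage_cube_le (R : ℝ) (h : ℝ≥0) (ω₀ ω : Fin 3 → (ℝ≥0 → ℝ)) :
    ENNReal.ofReal ((2 * (R + Real.sqrt 2 *
        ((∑ k, runSup h (ω₀ k)) + ∑ k, runSup h (ω k)))) ^ 3) ≤
      ENNReal.ofReal (1 + 128 * R ^ 4) + 110592 * ∑ k, ENNReal.ofReal (runSup h (ω₀ k) ^ 4) +
        110592 * ∑ k, ENNReal.ofReal (runSup h (ω k) ^ 4) := by
  have h4a : 0 ≤ ∑ k, runSup h (ω₀ k) ^ 4 := Finset.sum_nonneg fun k _ => by positivity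
  have h4b : 0 ≤ ∑ k, runSup h (ω k) ^ 4 := Finset.sum_nonneg fun k _ => by positivity
  have hR4 : 0 ≤ 1 + 128 * R ^ 4 := by positivity
  have h1 := sausage_cube_le R (∑ k, runSup h (ω₀ k)) (∑ k, runSup h (ω k))
  have h2 := sum_runSup_pow_four_le h ω₀
  have h3 := sum_runSup_pow_four_le h ω
  calc ENNReal.ofReal ((2 * (R + Real.sqrt 2 *
          ((∑ k, runSup h (ω₀ k)) + ∑ k, runSup h (ω k)))) ^ 3)
      ≤ ENNReal.ofReal (1 + 128 * R ^ 4 + 110592 * (∑ k, runSup h (ω₀ k) ^ 4) +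
          110592 * ∑ k, runSup h (ω k) ^ 4) := ENNReal.ofReal_le_ofReal (by linarith)
    _ = ENNReal.ofReal (1 + 128 * R ^ 4) + 110592 * ∑ k, ENNReal.ofReal (runSup h (ω₀ k) ^ 4) +
          110592 * ∑ k, ENNReal.ofReal (runSup h (ω k) ^ 4) := by
        rw [ENNReal.ofReal_add (add_nonneg hR4 (mul_nonneg (by norm_num) h4a))
            (mul_nonneg (by norm_num) h4b),
          ENNReal.ofReal_add hR4 (mul_nonneg (by norm_num) h4a),
          ENNReal.ofReal_mul (by norm_num : (0 : ℝ) ≤ 110592),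
          ENNReal.ofReal_mul (by norm_num : (0 : ℝ) ≤ 110592),
          ENNReal.ofReal_sum_of_nonneg (fun k _ => by positivity),
          ENNReal.ofReal_sum_of_nonneg (fun k _ => by positivity)]
        norm_num

/-! ### Integration: marginals and the fourth moment -/

/-- The fourth-moment functional `ω ↦ 110592 Σ_k ofReal (runSup h (ω k)⁴)` of one line is
measurable (`measurable_runSup`, `measurable_pi_apply`). -/
theorem measurable_quarticFunctional (h : ℝ≥0) :
    Measurable fun ω : Fin 3 → (ℝ≥0 → ℝ) =>
      (110592 : ℝ≥0∞) * ∑ k, ENNReal.ofReal (runSup h (ω k) ^ 4) :=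
  (Finset.measurable_sum (Finset.univ : Finset (Fin 3)) fun k _ =>
    ENNReal.measurable_ofReal.comp
      (((measurable_runSup h).comp (measurable_pi_apply k)).pow_const 4)).const_mul _

/-- **One-coordinate marginal**: under `wienerLine = ⨂_{k<3} preWienerMeasure` each coordinate
`ω k` has the pre-Wiener law (`MeasureTheory.measurePreserving_eval`), so
`∫ ofReal (runSup h (ω k)⁴) d wienerLine ≤ ofReal (18 h²)` (`lintegral_runSup_pow_four_le`). -/
theorem lintegral_runSup_apply_pow_four_le (h : ℝ≥0) (k : Fin 3) :
    ∫⁻ ω, ENNReal.ofReal (runSup h (ω k) ^ 4) ∂wienerLine ≤ ENNReal.ofReal (18 * (h : ℝ) ^ 2) := by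
  haveI := Literature.Probability.RandomPlanarGeometry.isProbabilityMeasure_preWienerMeasure'
  have hmp : MeasurePreserving (Function.eval k) wienerLine preWienerMeasure :=
    measurePreserving_eval (fun _ : Fin 3 => preWienerMeasure) k
  have hmeas : Measurable fun η : ℝ≥0 → ℝ => ENNReal.ofReal (runSup h η ^ 4) :=
    ENNReal.measurable_ofReal.comp ((measurable_runSup h).pow_const 4)
  calc ∫⁻ ω, ENNReal.ofReal (runSup h (ω k) ^ 4) ∂wienerLine
      = ∫⁻ η, ENNReal.ofReal (runSup h η ^ 4) ∂preWienerMeasure := hmp.lintegral_comp hmeas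
    _ ≤ ENNReal.ofReal (18 * (h : ℝ) ^ 2) := lintegral_runSup_pow_four_le h

/-- **The fourth-moment functional integrates to at most `110592 · 3 · ofReal (18 h²)`**
(`lintegral_const_mul`, `lintegral_finsetSum`, three marginals). -/
theorem lintegral_quarticFunctional_le (h : ℝ≥0) :
    ∫⁻ ω, (110592 : ℝ≥0∞) * ∑ k, ENNReal.ofReal (runSup h (ω k) ^ 4) ∂wienerLine ≤
      110592 * (3 * ENNReal.ofReal (18 * (h : ℝ) ^ 2)) := by
  have hmk : ∀ k : Fin 3,
      Measurable fun ω : Fin 3 → (ℝ≥0 → ℝ) => ENNReal.ofReal (runSup h (ω k) ^ 4) := fun k =>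
    ENNReal.measurable_ofReal.comp (((measurable_runSup h).comp (measurable_pi_apply k)).pow_const 4)
  rw [lintegral_const_mul _ (Finset.measurable_sum _ fun k _ => hmk k),
    lintegral_finsetSum _ fun k _ => hmk k]
  calc (110592 : ℝ≥0∞) * ∑ k, ∫⁻ ω, ENNReal.ofReal (runSup h (ω k) ^ 4) ∂wienerLine
      ≤ 110592 * ∑ _k : Fin 3, ENNReal.ofReal (18 * (h : ℝ) ^ 2) := by
        gcongr with k
        exact lintegral_runSup_apply_pow_four_le h k
    _ = 110592 * (3 * ENNReal.ofReal (18 * (h : ℝ) ^ 2)) := by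
        simp only [Finset.sum_const, Finset.card_univ, Fintype.card_fin, nsmul_eq_mul, Nat.cast_ofNat]

/-- **Bookkeeping of the double integral** over a probability measure: if
`F x y ≤ A + G x + G y` with `G` measurable and `∫ G ≤ B`, then `∫∫ F ≤ A + 2B`
(`lintegral_add_left/right`, `lintegral_const`, total mass one). -/
theorem lintegral_lintegral_le_of_le_add {α : Type*} [MeasurableSpace α] (μ : Measure α)
    [IsProbabilityMeasure μ] {F : α → α → ℝ≥0∞} {G : α → ℝ≥0∞} (hG : Measurable G) {A B : ℝ≥0∞}
    (hF : ∀ x y, F x y ≤ A + G x + G y) (hGB : ∫⁻ x, G x ∂μ ≤ B) :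
    ∫⁻ x, ∫⁻ y, F x y ∂μ ∂μ ≤ A + 2 * B := by
  calc ∫⁻ x, ∫⁻ y, F x y ∂μ ∂μ ≤ ∫⁻ x, ∫⁻ y, (A + G x) + G y ∂μ ∂μ :=
        lintegral_mono fun x => lintegral_mono fun y => hF x y
    _ = ∫⁻ x, ((A + G x) + ∫⁻ y, G y ∂μ) ∂μ := by
        refine lintegral_congr fun x => ?_
        rw [lintegral_add_right _ hG, lintegral_const, measure_univ, mul_one]
    _ ≤ ∫⁻ x, ((A + G x) + B) ∂μ := lintegral_mono fun x => by gcongr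
    _ = A + ∫⁻ x, G x ∂μ + B := by
        rw [lintegral_add_right _ measurable_const, lintegral_add_left measurable_const]
        simp only [lintegral_const, measure_univ, mul_one]
    _ ≤ A + B + B := by gcongr
    _ = A + 2 * B := by rw [two_mul, add_assoc]

/-- **The double integral at level `h`**:
`∫∫ ofReal ((2(R + √2(S_h(ω₀) + S_h(ω))))³) d wienerLine d wienerLine
  ≤ ofReal (1 + 128 R⁴) + 2 · (110592 · (3 · ofReal (18 h²)))` — finite, polynomial in `h`. -/
theorem lintegral_sausage_cube_le (R : ℝ) (h : ℝ≥0) :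
    ∫⁻ ω₀, ∫⁻ ω, ENNReal.ofReal ((2 * (R + Real.sqrt 2 *
        ((∑ k, runSup h (ω₀ k)) + ∑ k, runSup h (ω k)))) ^ 3) ∂wienerLine ∂wienerLine ≤
      ENNReal.ofReal (1 + 128 * R ^ 4) + 2 * (110592 * (3 * ENNReal.ofReal (18 * (h : ℝ) ^ 2))) :=
  lintegral_lintegral_le_of_le_add wienerLine
    (G := fun ω : Fin 3 → (ℝ≥0 → ℝ) => (110592 : ℝ≥0∞) * ∑ k, ENNReal.ofReal (runSup h (ω k) ^ 4))
    (measurable_quarticFunctional h) (fun ω₀ ω => ofReal_sausage_cube_le R h ω₀ ω)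
    (lintegral_quarticFunctional_le h)

end Summit.AtomisticToContinuum.BoseEinsteinCondensation.Cruxes.TwoReplicaTransienceBound.TracerDecoupling.SausageMoment

namespace Summit.AtomisticToContinuum.BoseEinsteinCondensation.Cruxes.TwoReplicaTransienceBound.TracerDecoupling

open Literature.Probability.Process (runSup)

/-- **Registered stub `stub_sausageMoment`** (crux stmt-AtomisticToContinuum-9687, line `SketchIdeator1`,
skeleton v6): the cubic Wiener-sausage moment `E_{ω₀,ω}[(2(R + √2(S_h(ω₀) + S_h(ω))))³]`,
`h = (2T)⁺`, `S_h(ω) = Σ_{k<3} runSup h (ω k)`, is bounded by ONE finite constant `K(R, T₀)` for all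
`T ≤ T₀`: `K := ofReal (1 + 128R⁴) + 2·(110592·(3·ofReal (18·((2T₀)⁺)²)))`
(`SausageMoment.lintegral_sausage_cube_le` at `h = (2T)⁺ ≤ (2T₀)⁺`). -/
theorem stub_sausageMoment :
    ∀ (R : ℝ), 0 ≤ R → ∀ (T₀ : ℝ), ∃ K : ENNReal, K ≠ ⊤ ∧ ∀ T : ℝ, T ≤ T₀ →
      ∫⁻ ω₀, ∫⁻ ω, ENNReal.ofReal ((2 * (R + Real.sqrt 2 *
          ((∑ k, runSup (2 * T).toNNReal (ω₀ k)) + ∑ k, runSup (2 * T).toNNReal (ω k)))) ^ 3)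
        ∂wienerLine ∂wienerLine ≤ K := by
  intro R _ T₀
  refine ⟨ENNReal.ofReal (1 + 128 * R ^ 4) +
      2 * (110592 * (3 * ENNReal.ofReal (18 * (((2 * T₀).toNNReal : ℝ≥0) : ℝ) ^ 2))), ?_, ?_⟩
  · exact ENNReal.add_ne_top.2 ⟨ENNReal.ofReal_ne_top, ENNReal.mul_ne_top (by norm_num)
      (ENNReal.mul_ne_top (by norm_num) (ENNReal.mul_ne_top (by norm_num) ENNReal.ofReal_ne_top))⟩
  · intro T hT
    have hle : (((2 * T).toNNReal : ℝ≥0) : ℝ) ≤ (2 * T₀).toNNReal :=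
      NNReal.coe_le_coe.2 (Real.toNNReal_le_toNNReal (by linarith))
    calc ∫⁻ ω₀, ∫⁻ ω, ENNReal.ofReal ((2 * (R + Real.sqrt 2 *
            ((∑ k, runSup (2 * T).toNNReal (ω₀ k)) + ∑ k, runSup (2 * T).toNNReal (ω k)))) ^ 3)
          ∂wienerLine ∂wienerLine
        ≤ ENNReal.ofReal (1 + 128 * R ^ 4) +
            2 * (110592 * (3 * ENNReal.ofReal (18 * (((2 * T).toNNReal : ℝ≥0) : ℝ) ^ 2))) :=
          SausageMoment.lintegral_sausage_cube_le R _
      _ ≤ ENNReal.ofReal (1 + 128 * R ^ 4) +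
            2 * (110592 * (3 * ENNReal.ofReal (18 * (((2 * T₀).toNNReal : ℝ≥0) : ℝ) ^ 2))) := by
          gcongr

end Summit.AtomisticToContinuum.BoseEinsteinCondensation.Cruxes.TwoReplicaTransienceBound.TracerDecoupling

end
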